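import Summits.QuantumFields.YangMills.Theorems.UnitScaleTiltProp7CurvedLandauCoreFibreSupT3
import Summits.QuantumFields.YangMills.Theorems.UnitScaleTiltProp7CurvedLandauRowA
import Summits.QuantumFields.YangMills.Theorems.UnitScaleTiltProp7LineIterVsEngineOfTower
import HarnessLib

/-!
# Route `UnitScaleTilt`, crux K1 «MinimiserStabilityRegPr» (stmt-QuantumFields-19200), route-R [RP] curved — THE RELATIVE POINCARÉ INEQUALITY ON THE NONLINEAR (0.4)-FIBRE,
# FINAL DISPLAY: for `U₀, W ∈ SU(2)` on the finest torus with `W̄^{(K−n)} = Ū₀^{(K−n)}`, `dist1(U₀(∂p)) ≤ εℓ⁻²` (`10¹⁴L⁹ε ≤ 1`), `‖W_e − U₀,e‖ ≤ ρ_W` (`2·10¹¹L⁹ℓρ_W ≤ 1`)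
# and `Σ‖D^*_{U₀}(WU₀* − 1)‖²_HS ≤ δΣ‖WU₀* − 1‖² + Z`:  `((1∕4)ℓ⁻² − (18 + 537600L⁴)δ)·Σ‖WU₀* − 1‖² − (18 + 537600L⁴)·Z ≤ (18 + 537600L⁴)·Σ‖curl_{U₀}(WU₀* − 1)‖²_HS`
# — NO recursion family, NO per-level datum, NO `Z_Q` displayed (k- and volume-uniform constants)

Cell `ym3-torus`, D-0154 (3c) twin-width seat `ym-routeR-w3` (gen 2); corollary of ✓ `…CurvedLandauCoreFibreSupT3` by existential instantiation of the recursion families of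
record (✓ `Prop7CurvedLandauRowA.exists_trueLinIter_family` ∕ `exists_reduced_family` ∕ `exists_coarseGauge_family`, ✓ `Prop7LineIterVsEngineOfTower.exists_pureLine_family` —
zero content: the families are DEFINED by their recursions).  THEOREMS ONLY (0 `def`, 0 `sorry`); `--supports stmt-QuantumFields-19200`, count-neutral.  YM₃ on T³ is a ladder
rung (R3), not the Clay problem; nothing here claims the stub, the crux, d = 4 or the mass gap.

THE POINT.  The conclusion of the curved linear core never mentions the families `Q, G, S, Λ` (they are the proof's bookkeeping of [Balaban1985Averaging]'s true linearised
descent along the background tower); once every row about them is a theorem (S2′ knit ✓ p601741 → (R-A)∕(R-B)∕(R-C) → `Q`-junction → (B7) masses → (B6) sups), they are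
instantiated inside the proof.  What the statement keeps is exactly the analytic content of route-R's (Λ) line (RULING №25): the relative Poincaré inequality for a competitor on
the (0.4)-fibre of a (14)-regular background, with the divergence budget `(δ, Z)` as the only slice datum (the Landau representative has `δ = Z = 0`, ✓ `divB_optimalRepr_eq`).

WHAT IS PROVED (ns `…Theorems.Prop7CurvedLandauCoreFibreFinalT3`): ★★★ `sum_normSq_le_curl_sq_on_fibre_T3`, ★★★ `relPoincare_on_fibre_T3` ((ii′) currency:
`… − (18+537600L⁴)(24576s² + 768(εℓ⁻²)²)Σ‖Y‖² … ≤ (18 + 537600L⁴)·4·Σ_p‖W(∂p)U₀(∂p)* − 1‖²`, `‖WU₀* − 1‖ ≤ s ≤ 1` bondwise).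
HONEST SCOPE.  Two `obtain`s and an `exact`; the mathematics is in the cited chain.  This is NOT stub P (whose registered pinned text is misstated-as-uniform, RULING №25) and
closes no item; it is the curved, nonlinear-fibre analogue of the flat N7∕N8 rows, stated for the consumer of the new (Λ) line.

References: T. Bałaban, CMP 99 (1985) 389–434 [Balaban1985BackgroundPropagators] (Thm 3.11 p.416); CMP 102 (1985) 277–309 [Balaban1985Variational] ((14)–(15) p.280,
(141)–(143) p.299, Prop. 7 p.299); CMP 98 (1985) 17–51 [Balaban1985Averaging] (Prop. 3 (122)–(126) p.36, Prop. 4 (134)–(135) p.38).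
-/

set_option autoImplicit false

noncomputable section

open scoped BigOperators Matrix.Norms.L2Operator Matrix

namespace Summit.QuantumFields.YangMills.Theorems.Prop7CurvedLandauCoreFibreFinalT3

open Literature.MathematicalPhysics.QuantumFieldTheory.Balaban1983to89
open Literature.MathematicalPhysics.QuantumFieldTheory.Balaban1983to89.T3ContinuumYM3Torus
open Finset T4Continuum T4ReflectionCone BlockAveraging AveragingRT ExpMeanLog BlockAveragingEMLLinearised BlockAveragingEMLLinearisedBackground
  BlockAveragingEMLProp2 B1RG242Torus
open B9Eq39Adjoint (curl divB)
open B10Eq27TorusAxialLog (holT unitsField toUField)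
open B9TorusCalculus (torusT)
open Summit.QuantumFields.YangMills.Theorems.Prop7CurvedLandauRowA (exists_trueLinIter_family exists_reduced_family exists_coarseGauge_family)
open Summit.QuantumFields.YangMills.Theorems.Prop7LineIterVsEngineOfTower (exists_pureLine_family)
open Summit.QuantumFields.YangMills.Theorems.Prop7CurvedLandauCoreFibreSupT3 (sum_normSq_le_curl_sq_core_of_fibre_sup_T3 relPoincare_core_of_fibre_sup_T3)

set_option maxHeartbeats 400000 in
/-- ★★★ **THE RELATIVE POINCARÉ INEQUALITY ON THE NONLINEAR (0.4)-FIBRE (d = 3, `SU(2)`), FINAL DISPLAY.**  `U₀, W` on the finest torus of run `K` with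
`W̄^{(K−n)} = Ū₀^{(K−n)}`; `dist1(U₀(∂p)) ≤ εℓ⁻²` (`ℓ = L^{K−n}`, `0 < ε`, `10¹⁴L⁹ε ≤ 1`); `‖W_e − U₀,e‖ ≤ ρ_W` bondwise with `2·10¹¹·L⁹·(ℓρ_W) ≤ 1`; the divergence budget
`Σ‖D^*_{U₀}(WU₀* − 1)‖²_HS ≤ δΣ‖WU₀* − 1‖² + Z`.  THEN
`((1∕4)ℓ⁻² − (18 + 537600L⁴)δ)·Σ_b‖(WU₀* − 1)(b)‖² − (18 + 537600L⁴)·Z ≤ (18 + 537600L⁴)·Σ_{x,μ<ν}‖curl_{U₀}(WU₀* − 1)(x)_{μν}‖²_HS`.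
[cite: Balaban1985BackgroundPropagators, Thm 3.11 p.416; Balaban1985Variational, (14)-(15) p.280, Prop. 7 p.299; Balaban1985Averaging, Prop. 3 (122)-(126) p.36, Prop. 4 (134)-(135) p.38] -/
theorem sum_normSq_le_curl_sq_on_fibre_T3 (F : T3Family) (n K : ℕ)
    (U₀ W : GaugeField (F.P K) 0 (Matrix.specialUnitaryGroup (Fin 2) ℂ)) {ε : ℝ} (hε : 0 < ε) (hεL : 100000000000000 * (F.L : ℝ) ^ 9 * ε ≤ 1)
    (hU : ∀ p : Plaq (F.P K) 0, dist1 (GaugeField.plaqHol U₀ p) ≤ ε * (((F.L : ℝ) ^ (K - n)) ^ 2)⁻¹)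
    (hfib : Averaging.iter (fun i => blockAvg (P := (F.P K)) (j := i) (expMeanLogSU (n := Fin 2))) (K - n) W = Averaging.iter (fun i => blockAvg (P := (F.P K)) (j := i) (expMeanLogSU (n := Fin 2))) (K - n) U₀)
    {δ Z : ℝ}
    (hdivB : (∑ x : Site (F.P K) 0, ∑ j : Fin 2, ∑ k : Fin 2,
            ‖(divB (torusT (F.P K) 0) (fun κ z => unitsField (toUField U₀) ⟨z, κ⟩) (fun κ z => pertVar U₀ W ⟨z, κ⟩) x) j k‖ ^ 2)
      ≤ δ * (∑ b : PBond (F.P K) 0, ‖pertVar U₀ W b‖ ^ 2) + Z)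
    {ρW : ℝ} (hρ0 : 0 ≤ ρW) (hρW : 200000000000 * (F.L : ℝ) ^ 9 * (((F.L : ℝ) ^ (K - n)) * ρW) ≤ 1)
    (hW : ∀ e : PBond (F.P K) 0, ‖((W e : Matrix.specialUnitaryGroup (Fin 2) ℂ) : Matrix (Fin 2) (Fin 2) ℂ) - ((U₀ e : Matrix.specialUnitaryGroup (Fin 2) ℂ) : Matrix (Fin 2) (Fin 2) ℂ)‖ ≤ ρW) :
    ((1 / 4) * ((((F.L : ℝ) ^ (K - n))) ^ 2)⁻¹ - (18 + 537600 * (F.L : ℝ) ^ 4) * δ) * (∑ b : PBond (F.P K) 0, ‖pertVar U₀ W b‖ ^ 2) - (18 + 537600 * (F.L : ℝ) ^ 4) * Z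
      ≤ (18 + 537600 * (F.L : ℝ) ^ 4) * (∑ x : Site (F.P K) 0, ∑ μ : Fin (F.P K).d, ∑ ν : Fin (F.P K).d,
            (if μ < ν then ∑ j : Fin 2, ∑ k : Fin 2,
              ‖(curl (torusT (F.P K) 0) (fun κ z => unitsField (toUField U₀) ⟨z, κ⟩) (fun κ z => pertVar U₀ W ⟨z, κ⟩) μ ν x) j k‖ ^ 2 else 0)) := by
  obtain ⟨Q, hQ0, hQs⟩ := exists_trueLinIter_family (N := 2) U₀
  obtain ⟨G, hG0, hGs⟩ := exists_reduced_family (N := 2) U₀ (pertVar U₀ W)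
  obtain ⟨Λ, hΛ0, hΛs⟩ := exists_coarseGauge_family (N := 2) U₀ G
  obtain ⟨S, hS0, hSs⟩ := exists_pureLine_family U₀ (pertVar U₀ W)
  exact sum_normSq_le_curl_sq_core_of_fibre_sup_T3 F n K U₀ W hε hεL hU hfib Q hQ0 hQs G S Λ hG0 hS0 hΛ0 hΛs hGs hSs hdivB hρ0 hρW hW

set_option maxHeartbeats 400000 in
/-- ★★★ **THE SAME IN THE (ii′) CURRENCY** (relative plaquettes on the right; `‖WU₀* − 1‖ ≤ s ≤ 1` bondwise):
`((1∕4)ℓ⁻² − (18 + 537600L⁴)(δ + 24576s² + 768(εℓ⁻²)²))·Σ‖WU₀* − 1‖² − (18 + 537600L⁴)·Z ≤ (18 + 537600L⁴)·4·Σ_p‖W(∂p)U₀(∂p)* − 1‖²`.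
[cite: Balaban1985Variational, (141)-(143) p.299; Balaban1985BackgroundPropagators, Thm 3.11 p.416] -/
theorem relPoincare_on_fibre_T3 (F : T3Family) (n K : ℕ)
    (U₀ W : GaugeField (F.P K) 0 (Matrix.specialUnitaryGroup (Fin 2) ℂ)) {ε : ℝ} (hε : 0 < ε) (hεL : 100000000000000 * (F.L : ℝ) ^ 9 * ε ≤ 1)
    (hU : ∀ p : Plaq (F.P K) 0, dist1 (GaugeField.plaqHol U₀ p) ≤ ε * (((F.L : ℝ) ^ (K - n)) ^ 2)⁻¹)
    (hfib : Averaging.iter (fun i => blockAvg (P := (F.P K)) (j := i) (expMeanLogSU (n := Fin 2))) (K - n) W = Averaging.iter (fun i => blockAvg (P := (F.P K)) (j := i) (expMeanLogSU (n := Fin 2))) (K - n) U₀)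
    {δ Z : ℝ}
    (hdivB : (∑ x : Site (F.P K) 0, ∑ j : Fin 2, ∑ k : Fin 2,
            ‖(divB (torusT (F.P K) 0) (fun κ z => unitsField (toUField U₀) ⟨z, κ⟩) (fun κ z => pertVar U₀ W ⟨z, κ⟩) x) j k‖ ^ 2)
      ≤ δ * (∑ b : PBond (F.P K) 0, ‖pertVar U₀ W b‖ ^ 2) + Z)
    {ρW : ℝ} (hρ0 : 0 ≤ ρW) (hρW : 200000000000 * (F.L : ℝ) ^ 9 * (((F.L : ℝ) ^ (K - n)) * ρW) ≤ 1)
    (hW : ∀ e : PBond (F.P K) 0, ‖((W e : Matrix.specialUnitaryGroup (Fin 2) ℂ) : Matrix (Fin 2) (Fin 2) ℂ) - ((U₀ e : Matrix.specialUnitaryGroup (Fin 2) ℂ) : Matrix (Fin 2) (Fin 2) ℂ)‖ ≤ ρW)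
    {s : ℝ} (hδW : ∀ b : PBond (F.P K) 0, ‖pertVar U₀ W b‖ ≤ s) (hs1 : s ≤ 1) :
    ((1 / 4) * ((((F.L : ℝ) ^ (K - n))) ^ 2)⁻¹ - (18 + 537600 * (F.L : ℝ) ^ 4) * δ
        - (18 + 537600 * (F.L : ℝ) ^ 4) * (24576 * s ^ 2 + 768 * (ε * ((((F.L : ℝ) ^ (K - n))) ^ 2)⁻¹) ^ 2)) * (∑ b : PBond (F.P K) 0, ‖pertVar U₀ W b‖ ^ 2) - (18 + 537600 * (F.L : ℝ) ^ 4) * Z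
      ≤ (18 + 537600 * (F.L : ℝ) ^ 4) * (4 * ∑ p : Plaq (F.P K) 0,
        ‖((GaugeField.plaqHol W p : Matrix.specialUnitaryGroup (Fin 2) ℂ) : Matrix (Fin 2) (Fin 2) ℂ)
          * star ((GaugeField.plaqHol U₀ p : Matrix.specialUnitaryGroup (Fin 2) ℂ) : Matrix (Fin 2) (Fin 2) ℂ) - 1‖ ^ 2) := by
  obtain ⟨Q, hQ0, hQs⟩ := exists_trueLinIter_family (N := 2) U₀
  obtain ⟨G, hG0, hGs⟩ := exists_reduced_family (N := 2) U₀ (pertVar U₀ W)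
  obtain ⟨Λ, hΛ0, hΛs⟩ := exists_coarseGauge_family (N := 2) U₀ G
  obtain ⟨S, hS0, hSs⟩ := exists_pureLine_family U₀ (pertVar U₀ W)
  exact relPoincare_core_of_fibre_sup_T3 F n K U₀ W hε hεL hU hfib Q hQ0 hQs G S Λ hG0 hS0 hΛ0 hΛs hGs hSs hdivB hρ0 hρW hW hδW hs1

end Summit.QuantumFields.YangMills.Theorems.Prop7CurvedLandauCoreFibreFinalT3

end
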